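import Summits.Ventures.PercRepro.Night2NonFatLine

/-!
# night-2: h21's cell `(2, 1)` with no fat closure and `V` a line plus at most five points (gen 37)

If `V = G ∖ K` contains a line `ℓ` (a set of rank `≤ 2`) with at most five points off it, every lossy basis pair is in the
line-plus-two regime: the basis `Q′ = Q ∖ K` has at most two points on `ℓ`, hence at least three off it, so `W = V ∖ Q′` has at
most two points off `ℓ`; and `W` has rank `≥ 4` (`W ∪ {z}` spans `V`), so `W` has at least two points off `ℓ` — exactly two,
`y₁, y₂`, with `A = Q′ ∖ ℓ` of size three and `Q′ ∩ ℓ` two points spanning `ℓ`; the points of `W` on `ℓ` lie in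
`cl (Q′ ∩ ℓ) ⊆ cl (Q ∖ A)` and `basis_pair_fair_of_line_plus_two` applies.  Hence
**`localShadowHall_nonfat_of_line`**: the cell `(2, 1)` with no fat closure whose `V` is a line plus `≤ 5` points satisfies the
local Hall inequality — an infinite family of cells of every size (`|G| = |ℓ| + 6 … |ℓ| + 11`), the nested-line geometries of
the numerics.
Paper: proofs/NIGHT-2-g37.md §5.
-/

namespace PercRepro.Shadow

open PercRepro.ThmH PercRepro.PerFlat

variable {α : Type*} [DecidableEq α] {M : Matroid α} [M.Finite] {G : Finset α}

/-- A subset of a set of rank equal to its size has rank equal to its size. -/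
theorem rkN_eq_card_of_subset_of_rkN_eq_card {Q S : Finset α} (hQ : rkN M Q = Q.card) (hS : S ⊆ Q) :
    rkN M S = S.card := by
  have h1 := rkN_le_card (M := M) S
  have h2 := rkN_union_le_add_card (M := M) S (Q \ S)
  rw [Finset.union_sdiff_of_subset hS, Finset.card_sdiff_of_subset hS] at h2
  have h3 := Finset.card_le_card hS
  omega

/-- `W = G ∖ Q` of a basis pair has rank at least four (`W ∪ {z}` spans the rank-`5` set `G ∖ B`). -/
theorem four_le_rkN_sdiff_insert (hd : (gr M \ G).card = 2)
    {B : Finset α} (hB : B ∈ thinMembers M 5 G) (z : α) :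
    4 ≤ rkN M (G \ insert z B) := by
  have h5 := five_le_rkN_sdiff_of_mem_Uq hd (mem_membersIn.1 (mem_thinMembers.1 hB).1).1
  have hsub : G \ B ⊆ insert z (G \ insert z B) := by
    intro e he
    rw [Finset.mem_sdiff] at he
    rw [Finset.mem_insert, Finset.mem_sdiff, Finset.mem_insert]
    by_cases hez : e = z
    · exact Or.inl hez
    · exact Or.inr ⟨he.1, fun h => h.elim hez he.2⟩
  have h1 := rkN_mono (M := M) hsub
  have h2 : rkN M (insert z (G \ insert z B)) ≤ rkN M (G \ insert z B) + 1 := by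
    have := rkN_union_le_add_card (M := M) (G \ insert z B) {z}
    rw [Finset.card_singleton] at this
    rw [Finset.insert_eq, Finset.union_comm]
    exact this
  omega

/-- **Every lossy basis pair of a cell whose `V` is a line plus at most five points is fair.** -/
theorem basis_pair_fair_of_line_cell (hG : G ∈ flatsQ M (5 + 1)) (hd : (gr M \ G).card = 2)
    (hk : kColoops M G = 1) (hs : ∀ e ∈ gr M, ∀ f ∈ gr M, e ≠ f → rkN M {e, f} = 2)
    (hl : ∀ e ∈ gr M, M.Indep {e}) (hnf : fatClosures M 5 G 2 = ∅) {ℓ : Finset α}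
    (hℓ : ℓ ⊆ G \ coloops M G) (hrℓ : rkN M ℓ ≤ 2) (h5 : ((G \ coloops M G) \ ℓ).card ≤ 5)
    {B : Finset α} (hB : B ∈ thinMembers M 5 G) (hnP : ¬ bigP M G B) {z : α} (hz : z ∈ G \ clF M B)
    (hl0 : loss M 5 G B z ≠ 0) :
    loss M 5 G B z ≤ rhoL M 5 G B z * lossIncomeH M 5 G (bigP M G) (dshGT2 M 5 G) B z := by
  have hd' : (gr M \ G).card ≤ 5 := by omega
  have hGg : G ⊆ gr M := (mem_flatsQ.1 hG).1
  have hBG : B ⊆ G := subset_G_of_mem_thinMembers hB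
  have hQG : insert z B ⊆ G := Finset.insert_subset (Finset.mem_sdiff.1 hz).1 hBG
  have hKB : coloops M G ⊆ B := coloops_subset_of_mem_thinMembers hG hd' hB
  have h4 := card_sdiff_eq_four_of_not_bigP hG hd hk hB hnP
  have hzB : z ∉ B := fun h => (Finset.mem_sdiff.1 hz).2 (subset_clF_of_subset_gr (hBG.trans hGg) h)
  -- `Q′ = Q ∖ K`: five points, independent
  set Q' : Finset α := insert z B \ coloops M G with hQ'
  have hQ'card : Q'.card = 5 := by
    have h1 : Q' = insert z (B \ coloops M G) := by
      rw [hQ']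
      ext e
      simp only [Finset.mem_sdiff, Finset.mem_insert]
      constructor
      · rintro ⟨h | h, hK⟩
        · exact Or.inl h
        · exact Or.inr ⟨h, hK⟩
      · rintro (rfl | ⟨h, hK⟩)
        · exact ⟨Or.inl rfl, fun hK => hzB (hKB hK)⟩
        · exact ⟨Or.inr h, hK⟩
    rw [h1, Finset.card_insert_of_notMem (fun h => hzB (Finset.mem_sdiff.1 h).1), h4]
  have hQ'Q : Q' ⊆ insert z B := Finset.sdiff_subset
  have hQ'V : Q' ⊆ G \ coloops M G := Finset.sdiff_subset_sdiff hQG (le_refl _)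
  have hQ'rk : rkN M Q' = Q'.card :=
    rkN_eq_card_of_subset_of_rkN_eq_card (rkN_insert_eq_card hG hd hk hB hnP hz) hQ'Q
  -- at most two basis points on `ℓ`
  have hQℓ : (Q' ∩ ℓ).card ≤ 2 := by
    have h1 := rkN_eq_card_of_subset_of_rkN_eq_card hQ'rk (Finset.inter_subset_left : Q' ∩ ℓ ⊆ Q')
    have h2 := rkN_mono (M := M) (Finset.inter_subset_right : Q' ∩ ℓ ⊆ ℓ)
    omega
  -- `A = Q′ ∖ ℓ` has at least three points
  have hAcard3 : 3 ≤ (Q' \ ℓ).card := by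
    have := Finset.card_sdiff_add_card_inter Q' ℓ
    omega
  have hAQ : Q' \ ℓ ⊆ insert z B \ coloops M G := Finset.sdiff_subset
  -- `W` has rank `≥ 4`, so at least two points off `ℓ`
  have hWV : G \ insert z B ⊆ G \ coloops M G := by
    intro e he
    rw [Finset.mem_sdiff] at he
    exact Finset.mem_sdiff.2 ⟨he.1, fun hK => he.2 (Finset.mem_insert_of_mem (hKB hK))⟩
  have hrW := four_le_rkN_sdiff_insert hd hB z
  have hW2 : 2 ≤ ((G \ insert z B) \ ℓ).card := by
    have hsub : G \ insert z B ⊆ ℓ ∪ ((G \ insert z B) \ ℓ) := by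
      intro e he
      rw [Finset.mem_union, Finset.mem_sdiff]
      by_cases heℓ : e ∈ ℓ
      · exact Or.inl heℓ
      · exact Or.inr ⟨he, heℓ⟩
    have h1 := rkN_mono (M := M) hsub
    have h2 := rkN_union_le_add_card (M := M) ℓ ((G \ insert z B) \ ℓ)
    omega
  -- and at most two: `W ∖ ℓ` and `Q′ ∖ ℓ` are disjoint subsets of `V ∖ ℓ`
  have hWQ' : Disjoint (G \ insert z B) Q' := by
    rw [Finset.disjoint_left]
    intro e heW heQ'
    exact (Finset.mem_sdiff.1 heW).2 (hQ'Q heQ')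
  have hunion : ((G \ insert z B) \ ℓ) ∪ (Q' \ ℓ) ⊆ (G \ coloops M G) \ ℓ := by
    apply Finset.union_subset
    · exact Finset.sdiff_subset_sdiff hWV (le_refl _)
    · exact Finset.sdiff_subset_sdiff hQ'V (le_refl _)
  have hdisj : Disjoint ((G \ insert z B) \ ℓ) (Q' \ ℓ) := Finset.disjoint_of_subset_left Finset.sdiff_subset
    (Finset.disjoint_of_subset_right Finset.sdiff_subset hWQ')
  have hcardU := Finset.card_le_card hunion
  rw [Finset.card_union_of_disjoint hdisj] at hcardU
  have hW2' : ((G \ insert z B) \ ℓ).card = 2 := by omega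
  have hAcard : (Q' \ ℓ).card = 3 := by omega
  -- the two points off `ℓ`
  obtain ⟨y₁, y₂, hne, hy⟩ := Finset.card_eq_two.1 hW2'
  have hy₁ : y₁ ∈ G \ insert z B := by
    have : y₁ ∈ (G \ insert z B) \ ℓ := by rw [hy]; exact Finset.mem_insert_self _ _
    exact (Finset.mem_sdiff.1 this).1
  have hy₂ : y₂ ∈ G \ insert z B := by
    have : y₂ ∈ (G \ insert z B) \ ℓ := by rw [hy]; exact Finset.mem_insert_of_mem (Finset.mem_singleton_self _)
    exact (Finset.mem_sdiff.1 this).1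
  -- the two basis points on `ℓ` span it
  have hQℓ2 : (Q' ∩ ℓ).card = 2 := by
    have := Finset.card_sdiff_add_card_inter Q' ℓ
    omega
  have hℓcl : ℓ ⊆ clF M (Q' ∩ ℓ) := by
    have hℓg : ℓ ⊆ gr M := hℓ.trans (Finset.sdiff_subset.trans hGg)
    have heq : clF M (Q' ∩ ℓ) = clF M ℓ := by
      apply clF_eq_clF_of_subset_clF_of_rkN_le hℓg
      · exact (Finset.inter_subset_right : Q' ∩ ℓ ⊆ ℓ).trans (subset_clF_of_subset_gr hℓg)
      · rw [rkN_eq_card_of_subset_of_rkN_eq_card hQ'rk (Finset.inter_subset_left : Q' ∩ ℓ ⊆ Q'), hQℓ2]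
        exact hrℓ
    rw [heq]
    exact subset_clF_of_subset_gr hℓg
  have hQℓA : Q' ∩ ℓ ⊆ insert z B \ (Q' \ ℓ) := by
    intro e he
    rw [Finset.mem_inter] at he
    rw [Finset.mem_sdiff, Finset.mem_sdiff, not_and, not_not]
    exact ⟨hQ'Q he.1, fun _ => he.2⟩
  apply basis_pair_fair_of_line_plus_two hG hd hk hs hl hnf hB hnP hz hl0 hAQ hAcard hne hy₁ hy₂
  intro y hyW hy1 hy2
  have hyℓ : y ∈ ℓ := by
    by_contra hyℓ
    have : y ∈ (G \ insert z B) \ ℓ := Finset.mem_sdiff.2 ⟨hyW, hyℓ⟩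
    rw [hy, Finset.mem_insert, Finset.mem_singleton] at this
    rcases this with h | h
    · exact hy1 h
    · exact hy2 h
  exact clF_mono hQℓA (hℓcl hyℓ)

/-- **The cell `(2, 1)` with no fat closure whose `V` is a line plus at most five points satisfies the local Hall inequality.** -/
theorem localShadowHall_nonfat_of_line (hG : G ∈ flatsQ M (5 + 1)) (hd : (gr M \ G).card = 2)
    (hk : kColoops M G = 1) (hs : ∀ e ∈ gr M, ∀ f ∈ gr M, e ≠ f → rkN M {e, f} = 2)
    (hl : ∀ e ∈ gr M, M.Indep {e}) (hnf : fatClosures M 5 G 2 = ∅) {ℓ : Finset α}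
    (hℓ : ℓ ⊆ G \ coloops M G) (hrℓ : rkN M ℓ ≤ 2) (h5 : ((G \ coloops M G) \ ℓ).card ≤ 5) :
    LocalShadowHall M 5 G := by
  have hfat : (fatClosures M 5 G 2).card ≤ 1 := by
    rw [hnf, Finset.card_empty]
    exact zero_le_one
  apply localShadowHall_of_gt2_of_basis_fair hG hd hk hs hl hfat
  intro B hB hnP z hz
  by_cases hl0 : loss M 5 G B z = 0
  · rw [hl0]
    have hd' : (gr M \ G).card ≤ 5 := by omega
    have h1 : 0 ≤ rhoL M 5 G B z := by
      unfold rhoL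
      rw [hl0]
      simp
    have h2 : 0 ≤ lossIncomeH M 5 G (bigP M G) (dshGT2 M 5 G) B z :=
      lossIncomeH_nonneg hG hd' (column_side_gt2 hG hd hk hs hl hfat) B z
    positivity
  · exact basis_pair_fair_of_line_cell hG hd hk hs hl hnf hℓ hrℓ h5 hB hnP hz hl0

end PercRepro.Shadow
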